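import Literature.NumberTheory.Automorphic.TunnellCubicLiftsOfLanglandsLemma
import HarnessLib

/-!
# Tunnell's cubic lifts are cuspidal: the fact split into non-normal cubic base change and
# Langlands' lemma for `GL_2`

Fact split (librarian, 2026-08-16) of the named fact
`Literature.NumberTheory.Automorphic.tunnell_cuspidal_cubic_lifts` (`TunnellLemma`: in Tunnell's
setting — `σ` octahedral, `E/F` the quadratic and `K/F` the non-normal cubic subextension of
Tunnell, Bull. AMS 5 (1981), p. 174, `π` a cuspidal weak descent of `π(σ_E)` — `π` has a
**cuspidal** weak base change lift to `GL_2(𝔸_K)`).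

The reduction chain `TunnellCubicLifts` → `TunnellCubicLiftsNonMonomial` → `TunnellCubicLiftsLeaves`
→ `TunnellCubicLiftsOfLanglandsLemma` PROVED the fact from exactly two results of the general
theory, threaded there as hypotheses `h1`, `hE` of
`tunnell_cuspidal_cubic_lifts_of_jpss_of_eisensteinQuotients` because a proof file may not vendor
named facts. This file names them (the two CHILDREN of the split) and records the assembly:

* `JPSS1981_cubicBaseChange_gl2` — **non-normal cubic base change for `GL(2)`**
  (Jacquet–Piatetski-Shapiro–Shalika 1981; Tunnell's Theorem [4], p. 173, verbatim): every
  cuspidal `π` on `GL_2(𝔸_F)` has an automorphic weak base change lift to `GL_2(𝔸_K)` for every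
  cubic extension `K/F`;
* `Langlands1979_eisensteinConstituent_gl2` — **Langlands' lemma for `GL_2`, for the constituents
  of `𝒜 / 𝒜₀`** (Langlands 1979, Prop. 2, where the constant term enters): an irreducible
  constituent of the space of automorphic forms on `GL_2(𝔸_K)` modulo cusp forms is nearly
  equivalent to a cuspidal representation or has Satake parameters `{μ₁(ϖ_w), μ₂(ϖ_w)}` at almost
  all `w` for two Hecke (quasi-)characters `μ₁, μ₂` of `K`; the extension to all automorphic
  representations is the tree's PROVED `AutomorphicRepData.langlandsDichotomy_of_nonCuspidal`;
* `tunnell_cuspidal_cubic_lifts_holds_of : JPSS1981_cubicBaseChange_gl2 →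
  Langlands1979_eisensteinConstituent_gl2 → tunnell_cuspidal_cubic_lifts` — PROVED (it is
  `tunnell_cuspidal_cubic_lifts_of_jpss_of_eisensteinQuotients`).

Neither child restates the parent: `h1` has no cuspidality clause and no octahedral setting, `hE`
is a statement about `GL_2` over one number field; the octahedral argument excluding the
Eisenstein case (Tunnell p. 174, on the Galois side over the compositum `M`) is the proved content
of `TunnellCubicLiftsOfLanglandsLemma`.

## References

* H. Jacquet, I. I. Piatetski-Shapiro, J. Shalika, *Relèvement cubique non normal*, C. R. Acad.
  Sci. Paris Sér. I 292 (1981), 567–571, Théorème. [JPSS1981Cubique]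
* J. Tunnell, *Artin's conjecture for representations of octahedral type*, Bull. AMS (N.S.) 5
  (1981), 173–175: Theorem [4] (p. 173), Lemma (p. 174). [Tunnell1981]
* S. Gelbart, *Three lectures …*, in *Modular Forms and Fermat's Last Theorem* (1997), §7.2,
  Proposition (p. 258) and Lemma (p. 259). [Gelbart1997]
* R. P. Langlands, *On the notion of an automorphic representation*, Proc. Sympos. Pure Math. 33
  (1979), Part 1, 203–207, Prop. 2 and its proof (pp. 204–205). [LanglandsNotion1979]
* A. Borel, H. Jacquet, *Automorphic forms and automorphic representations*, PSPM 33.1 (1979),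
  4.6. [BorelJacquet1979]
-/

noncomputable section

open scoped MatrixGroups NumberField Polynomial Classical
open NumberField IsDedekindDomain Field Polynomial Literature.NumberTheory.Automorphic Filter

namespace Literature.NumberTheory.Automorphic

open Literature.NumberTheory.GaloisRepresentations

/-! ### The two children -/

/-- **Non-normal cubic base change for `GL(2)` (CHILD 1 of the split of
`tunnell_cuspidal_cubic_lifts`).** Jacquet–Piatetski-Shapiro–Shalika (1981), as quoted by
Tunnell (1981), Theorem [4], p. 173: "Let `K` be a cubic extension of `F` (not necessarily
Galois). For each automorphic cuspidal representation `π` of `GL(2, 𝔸_F)` there exists an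
automorphic representation `Π = BC_{K/F}(π)` of `GL(2, 𝔸_K)` such that for almost all places `v`
of `F`, and each place `w` of `K` dividing `v`, [`Π_w` is the base change lift of `π_v`]" — at the
unramified places: `t_{Π,w} = t_{π,v}^{f(w|v)}` (`IsWeakBaseChangeLiftAE`). Gelbart (1997), §7.2,
Proposition p. 258 (the lift is introduced through `L(s, Π × χ) = L(s, π × π(χ))` and the converse
theorem). Stated for every cubic extension of number fields, in the adelic vocabulary of
`AutomorphicRepsGL`; no cuspidality of `Π` is asserted. [cite: JPSS1981Cubique, Théorème]
[cite: Tunnell1981, Theorem [4] (p. 173)] [cite: Gelbart1997, §7.2 Proposition (p. 258)] -/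
def JPSS1981_cubicBaseChange_gl2 : Prop :=
  ∀ (F K : Type) [Field F] [NumberField F] [Field K] [NumberField K] [Algebra F K],
    Module.finrank F K = 3 →
    ∀ (hF : isCompact_glFiniteIntegralLevel 2 F) (hK : isCompact_glFiniteIntegralLevel 2 K)
      (π : CuspidalAutomorphicRepData 2 F hF),
      ∃ P : AutomorphicRepData (AutomorphyDatum.gl 2 K hK), IsWeakBaseChangeLiftAE π.1 P

/-- **Langlands' lemma for `GL_2`, for the constituents of `𝒜 / 𝒜₀` (CHILD 2 of the split of
`tunnell_cuspidal_cubic_lifts`).** Langlands (1979), Prop. 2: "`π` is an automorphic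
representation if and only if `π` is a constituent of `Ind σ` for some [cuspidal] pair `(P, σ)`"
— proof, pp. 204–205: a constituent of the space of automorphic forms not met by the cusp forms
is, through its constant terms, a constituent of a representation induced from cuspidal data of a
proper parabolic; for `GL_2` the proper parabolic is the Borel and the data a pair of Hecke
(quasi-)characters `μ₁, μ₂`, whose induced representation has Satake parameters
`{μ₁(ϖ_w), μ₂(ϖ_w)}` at the unramified places (Borel–Jacquet 1979, 4.6; Getz–Hahn 2024,
Thm. 10.6.1 with Thm. 10.5.3). Rendered in the tree's vocabulary (`AutomorphicRepCuspidalPart`):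
for every number field `K` and every automorphic representation `P₁` of `GL_2(𝔸_K)` realised on a
subquotient of `𝒜 / 𝒜₀` (`cuspFormsGL 2 K hK ≤ P₁.W'`), either `P₁` is nearly equivalent to a
cuspidal automorphic representation, or there are Hecke characters `μ₁, μ₂` of `K` with
`t_{P₁,w} = {μ₁(ϖ_w), μ₂(ϖ_w)}` for almost all `w`. (The dichotomy for ALL automorphic
representations follows: `AutomorphicRepData.langlandsDichotomy_of_nonCuspidal`, proved.)
[cite: LanglandsNotion1979, Prop. 2 (proof, pp. 204–205)] [cite: BorelJacquet1979, 4.6] -/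
def Langlands1979_eisensteinConstituent_gl2 : Prop :=
  ∀ (K : Type) [Field K] [NumberField K] (hK : isCompact_glFiniteIntegralLevel 2 K)
    (P₁ : AutomorphicRepData (AutomorphyDatum.gl 2 K hK)), cuspFormsGL 2 K hK ≤ P₁.W' →
    (∃ P₀ : CuspidalAutomorphicRepData 2 K hK, P₁.IsNearlyEquivalent P₀.1) ∨
    ∃ μ₁ μ₂ : HeckeCharacter K, ∀ᶠ w in cofinite,
      P₁.HasSatakeParamAt w {μ₁.valueAtUniformizer w, μ₂.valueAtUniformizer w}

/-! ### Assembly -/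

/-- **Assembly of the split (PROVED): non-normal cubic base change and Langlands' lemma for the
constituents of `𝒜 / 𝒜₀` on `GL_2` imply that Tunnell's cubic lifts are cuspidal** — this is
`tunnell_cuspidal_cubic_lifts_of_jpss_of_eisensteinQuotients` (`TunnellCubicLiftsOfLanglandsLemma`:
the Eisenstein case is refuted on the Galois side over the compositum `M ⊇ E, K`, Tunnell 1981,
p. 174). [cite: Tunnell1981, Theorem [4] (pp. 173–174) and Lemma (p. 174)] -/
theorem tunnell_cuspidal_cubic_lifts_holds_of (h1 : JPSS1981_cubicBaseChange_gl2)
    (hE : Langlands1979_eisensteinConstituent_gl2) : tunnell_cuspidal_cubic_lifts :=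
  tunnell_cuspidal_cubic_lifts_of_jpss_of_eisensteinQuotients h1 hE

end Literature.NumberTheory.Automorphic

end
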